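import Summits.ResolutionOfSingularities.KangarooAtlas.MizutaniCasesTwo
import HarnessLib

/-!
# Mizutani's conjecture `m(e) = 2p^e − 1` — the combinatorial cases, II: a good layer (`s ≥ 3`)

Cell topic `Summits/ResolutionOfSingularities/KangarooAtlas` (pub-rosobs); namespace
`Summit.ResolutionOfSingularities.KangarooAtlas.Mizutani`.  Part of the Lean transcription of the
in-house note MIZUTANI-PROOF-g59 (AI-written, AI-audited; *AI review is weaker than expert review*; not a
resolution theorem).  `exists_good_layer` (`ι = Fin (n+1)`, `n ≥ 2`; the note's §7 (L1)–(L4) and Cases A/B of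
THEOREM E(s)): a move-closed admissible set containing a genuine point has a coordinate `c` and a height `h`
such that every `M ∈ S` with `M_c = h` has `|M| − h ≥ q` and some such `M` is GENUINE after deleting the
`c`-th coordinate.  Case A (minimal genuine excess `< (n−1)(p−1)`): pour the last coordinate of the reduced
point away (layer `(last, 0)`); Case B: the layer `(1, r_1)` of the reduced point.

References: [Mizutani1973HironakaGroupSchemes] (Remark 2.10; in-house proof §7).
-/

open MvPolynomial

namespace Summit.ResolutionOfSingularities.KangarooAtlas.Mizutani

/-! ## `s ≥ 3`: a good layer (Cases A and B) -/

section Layer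

variable {p e : ℕ} [Fact p.Prime]

/-- `(a + t)/p = a/p` when the units digit does not overflow. [folklore] -/
theorem add_div_eq_of_mod_add_lt {p a t : ℕ} (hp : 0 < p) (h : a % p + t < p) : (a + t) / p = a / p := by
  have ha := Nat.div_add_mod a p
  calc (a + t) / p = (p * (a / p) + (a % p + t)) / p := by rw [← add_assoc, ha]
    _ = a / p + (a % p + t) / p := Nat.mul_add_div hp _ _
    _ = a / p := by rw [Nat.div_eq_of_lt h, add_zero]

omit [Fact p.Prime] in
/-- A single coordinate's floor is at most the total floor. [folklore] -/
theorem div_le_floorSum {ι : Type*} [Fintype ι] (M : ι →₀ ℕ) (j : ι) : M j / p ≤ floorSum p M := by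
  rw [floorSum_eq_sum]
  exact Finset.single_le_sum (f := fun l => M l / p) (fun _ _ => Nat.zero_le _) (Finset.mem_univ j)

/-- **A good layer for at least three directions** (MIZUTANI-PROOF-g59 §7, proof of THEOREM E(s), Cases A/B
with (L1)–(L4)): a move-closed admissible set in `[0,q−1]^{n+1}`, `n ≥ 2`, containing a genuine point has a
coordinate `c` and a height `h` such that the layer `{M ∈ S : M_c = h}`, read in the remaining `n`
coordinates, consists of points of degree `≥ q` and contains a genuine point.  Case A (minimal genuine
excess `< (n−1)(p−1)`): pour the last coordinate of the reduced point away (layer `(last, 0)`); Case B: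
the layer `(1, r_1)` of the reduced point. [cite: Mizutani1973HironakaGroupSchemes, Remark 2.10 (in-house proof §7, Theorem E(s))] -/
theorem exists_good_layer (he : 1 ≤ e) {n : ℕ} (hn : 2 ≤ n) {S : Finset (Fin (n + 1) →₀ ℕ)}
    (hS : MoveClosed p (p ^ e) S) (hadm : ∀ M ∈ S, InBox (p ^ e) M ∧ p ^ e ≤ M.degree)
    (hgen : ∃ G ∈ S, IsGenuine p e G) :
    ∃ (c : Fin (n + 1)) (h : ℕ), (∀ M ∈ S, M c = h → p ^ e ≤ (removeAt c M).degree) ∧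
      ∃ M ∈ S, M c = h ∧ IsGenuine p e (removeAt c M) := by
  classical
  have hp : 0 < p := (Fact.out : p.Prime).pos
  have hqe : p ^ e = p * p ^ (e - 1) := by rw [← pow_succ']; congr 1; omega
  have hpe : p ≤ p ^ e := by
    calc p = p ^ 1 := (pow_one p).symm
      _ ≤ p ^ e := Nat.pow_le_pow_right hp he
  -- a genuine point of minimal degree
  obtain ⟨G₀, hG₀S, hG₀⟩ := hgen
  obtain ⟨G, hGf, hGmin⟩ := Finset.exists_min_image (S.filter fun M => IsGenuine p e M)
    (fun M => M.degree) ⟨G₀, Finset.mem_filter.mpr ⟨hG₀S, hG₀⟩⟩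
  have hGS : G ∈ S := (Finset.mem_filter.mp hGf).1
  have hG : IsGenuine p e G := (Finset.mem_filter.mp hGf).2
  have hGmin' : ∀ M ∈ S, IsGenuine p e M → G.degree ≤ M.degree := fun M hM hMg =>
    hGmin M (Finset.mem_filter.mpr ⟨hM, hMg⟩)
  have hΦlt : floorSum p G + 1 ≤ p ^ (e - 1) := hG.2.2
  have hdegG : p ^ e ≤ G.degree := hG.2.1
  -- three distinct coordinates: accumulator `a`, big sink `b`, the coordinate `z` to be emptied
  set a : Fin (n + 1) := ⟨0, by omega⟩ with ha
  set b : Fin (n + 1) := ⟨1, by omega⟩ with hb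
  set z : Fin (n + 1) := ⟨n, by omega⟩ with hz
  have hab : a ≠ b := by simp [ha, hb, Fin.ext_iff]
  have hbz : b ≠ z := by simp [hb, hz, Fin.ext_iff]; omega
  have haz : a ≠ z := by simp [ha, hz, Fin.ext_iff]; omega
  -- the reduced point
  obtain ⟨P₀, hP₀S, hP₀a, hP₀j, hdeg₀, hfl₀, hbox₀⟩ := exists_reduced_point hS a hGS hG he
  have hP₀lt : ∀ j, j ≠ a → P₀ j < p := fun j hj => by rw [hP₀j j hj]; exact Nat.mod_lt _ hp
  have hP₀b : P₀ b < p := hP₀lt b hab.symm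
  have hP₀z : P₀ z < p := hP₀lt z haz.symm
  -- degree identity `|P₀| = pΦ + Σ (P₀_j mod p)`
  have hdegP₀ : P₀.degree = p * floorSum p G + ∑ j, P₀ j % p := by
    rw [degree_eq_floorSum_add_mods (p := p) P₀, hfl₀]
  by_cases hcase : (n - 1) * (p - 1) + p ^ e ≤ G.degree
  · /- Case B: the layer `(b, r_b)` -/
    have hh : P₀ b + 1 ≤ p := hP₀b
    have hnp : p - 1 ≤ (n - 1) * (p - 1) := Nat.le_mul_of_pos_left _ (by omega)
    refine ⟨b, P₀ b, fun M hM hMb => ?_, P₀, hP₀S, rfl, ?_⟩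
    · have hdr := degree_removeAt_add b M
      have hfr := floorSum_removeAt_add (p := p) b M
      by_cases hMfl : floorSum p M < p ^ (e - 1)
      · have hMg : IsGenuine p e M := ⟨(hadm M hM).1, (hadm M hM).2, hMfl⟩
        have := hGmin' M hM hMg
        omega
      · push Not at hMfl
        have hMb0 : M b / p = 0 := Nat.div_eq_of_lt (by omega)
        have h1 := mul_floorSum_le_degree (p := p) (removeAt b M)
        have h2 : p * p ^ (e - 1) ≤ p * floorSum p (removeAt b M) :=
          Nat.mul_le_mul_left p (by omega)
        omega
    · refine ⟨inBox_removeAt b hbox₀, ?_, ?_⟩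
      · have hdr := degree_removeAt_add b P₀
        omega
      · have hfr := floorSum_removeAt_add (p := p) b P₀
        rw [Nat.div_eq_of_lt hP₀b, add_zero] at hfr
        omega
  · /- Case A: pour `z` away; the layer `(z, 0)` -/
    push Not at hcase
    set J : Finset (Fin (n + 1)) := (Finset.univ.erase b).erase z with hJ
    have hzJ : z ∉ J := Finset.notMem_erase z _
    have hbJ : b ∉ J := fun h => (Finset.notMem_erase b Finset.univ) (Finset.mem_of_mem_erase h)
    have hcardJ : J.card = n - 1 := by
      rw [hJ, Finset.card_erase_of_mem (Finset.mem_erase.mpr ⟨hbz.symm, Finset.mem_univ z⟩),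
        Finset.card_erase_of_mem (Finset.mem_univ b), Finset.card_univ, Fintype.card_fin]
      omega
    -- capacities of the small sinks and the allocation
    set cap : Fin (n + 1) → ℕ := fun j => p - 1 - P₀ j % p with hcap
    set K := ∑ j ∈ J, cap j with hK
    set K' := min K (P₀ z) with hK'
    obtain ⟨t, htle, -, hts⟩ := exists_alloc cap J K' (min_le_left _ _)
    -- room in the small sinks
    have hroom : ∀ j ∈ J, P₀ j + t j < p ^ e := by
      intro j _
      have h1 : t j ≤ cap j := htle j
      have h2 : P₀ j / p ≤ floorSum p G := by rw [← hfl₀]; exact div_le_floorSum (p := p) P₀ j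
      have h3 := Nat.div_add_mod (P₀ j) p
      have h4 : P₀ j % p < p := Nat.mod_lt _ hp
      have h5 : p * (P₀ j / p) + p ≤ p * p ^ (e - 1) := by
        rw [← mul_add_one]; exact Nat.mul_le_mul_left p (by omega)
      simp only [hcap] at h1
      omega
    obtain ⟨P₁, hP₁S, hP₁z, hP₁J, hP₁oth, hdeg₁, hfl₁⟩ :=
      exists_pour hS z t J hzJ P₀ hP₀S hP₀z (by rw [hts]; exact min_le_right _ _) hroom
    -- the floor did not move: no small sink overflowed
    have hfl₁' : floorSum p P₁ = floorSum p G := by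
      have hterm : ∀ j ∈ J, (P₀ j + t j) / p = P₀ j / p := by
        intro j _
        have h1 : t j ≤ cap j := htle j
        have h4 : P₀ j % p < p := Nat.mod_lt _ hp
        simp only [hcap] at h1
        exact add_div_eq_of_mod_add_lt hp (by omega)
      rw [Finset.sum_congr rfl hterm, hfl₀] at hfl₁
      omega
    have hP₁b : P₁ b = P₀ b := hP₁oth b hbz hbJ
    -- the rest goes into `b`
    set R := P₀ z - K' with hR
    have hP₁z' : P₁ z = R := by rw [hP₁z, hts]
    -- the key count: `r_b + R < p·(p^{e−1} − Φ)` when `R > 0`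
    have hroomb : P₁ b + R < p ^ e ∧ P₀ b + R + p * floorSum p G < p ^ e := by
      by_cases hR0 : R = 0
      · rw [hR0, add_zero, add_zero, hP₁b]
        constructor
        · omega
        · have : p * floorSum p G + p ≤ p * p ^ (e - 1) := by
            rw [← mul_add_one]; exact Nat.mul_le_mul_left p hΦlt
          omega
      · -- `K < r_z`, so `K' = K`
        have hK'K : K' = K := by
          rw [hK']
          apply min_eq_left
          by_contra hlt
          push Not at hlt
          apply hR0
          rw [hR, hK', min_eq_right hlt.le, Nat.sub_self]
        -- identities (E2), (E3)
        have hE2 : ∑ j, P₀ j % p = P₀ b % p + P₀ z % p + ∑ j ∈ J, P₀ j % p :=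
          sum_eq_add_add_sum_erase (fun j => P₀ j % p) hbz
        have hE3 : K + ∑ j ∈ J, P₀ j % p = (n - 1) * (p - 1) := by
          rw [hK, ← Finset.sum_add_distrib, ← hcardJ, ← smul_eq_mul, ← Finset.sum_const]
          refine Finset.sum_congr rfl fun j _ => ?_
          have h4 : P₀ j % p < p := Nat.mod_lt _ hp
          simp only [hcap]
          omega
        have hmb : P₀ b % p = P₀ b := Nat.mod_eq_of_lt hP₀b
        have hmz : P₀ z % p = P₀ z := Nat.mod_eq_of_lt hP₀z
        rw [hmb, hmz] at hE2
        have hKz : K ≤ P₀ z := by rw [← hK'K]; exact min_le_right _ _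
        rw [hP₁b]
        constructor <;> omega
    obtain ⟨P₂, hP₂S, hP₂z, hP₂b, -, -, hfl₂⟩ :=
      exists_pour hS z (fun _ => R) {b} (by rw [Finset.mem_singleton]; exact fun h => hbz h.symm) P₁ hP₁S
        (by rw [hP₁z']; omega) (by rw [Finset.sum_singleton, hP₁z'])
        (fun j hj => by rw [Finset.mem_singleton] at hj; subst hj; exact hroomb.1)
    rw [Finset.sum_singleton, hP₁z', Nat.sub_self] at hP₂z
    have hflP₂ : floorSum p P₂ = floorSum p G + (P₀ b + R) / p := by
      rw [Finset.sum_singleton, Finset.sum_singleton, hfl₁', hP₁b, Nat.div_eq_of_lt hP₀b,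
        add_zero] at hfl₂
      exact hfl₂
    -- the layer `(z, 0)`
    refine ⟨z, 0, fun M hM hMz => ?_, P₂, hP₂S, hP₂z, ?_⟩
    · have hdr := degree_removeAt_add z M
      have := (hadm M hM).2
      omega
    · refine ⟨inBox_removeAt z (hadm P₂ hP₂S).1, ?_, ?_⟩
      · have hdr := degree_removeAt_add z P₂
        have := (hadm P₂ hP₂S).2
        omega
      · have hfr : floorSum p (removeAt z P₂) = floorSum p P₂ := by
          have := floorSum_removeAt_add (p := p) z P₂
          rw [hP₂z, Nat.zero_div, add_zero] at this
          exact this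
        -- `floor(P₂) = Φ + ⌊(r_b + R)/p⌋ < p^{e−1}`
        have h1 : P₀ b + R < p * (p ^ (e - 1) - floorSum p G) := by
          have := hroomb.2
          rw [hqe] at this
          have hsub : p * (p ^ (e - 1) - floorSum p G) = p * p ^ (e - 1) - p * floorSum p G :=
            Nat.mul_sub _ _ _
          omega
        have h2 := Nat.div_lt_of_lt_mul h1
        rw [hfr, hflP₂]
        omega

end Layer

end Summit.ResolutionOfSingularities.KangarooAtlas.Mizutani
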